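import Summits.KontsevichZagierPeriods.KontsevichZagierPeriods.Theses.KinematicFormulas
import Literature.NumberTheory.Transcendental.KZProductIdeal
import Literature.NumberTheory.Transcendental.KZLogCalculusProofs

/-!
# Crux `KinematicPlaneConvexR` (stmt-KontsevichZagierPeriods-10736) — alternative skeleton line `gaugechart`

Route: route-KontsevichZagierPeriods-KinematicFormulas (THE PLANE ENGINE, crux rank 2). Strategist line,
registered ALONGSIDE `Lines/birth.lean` (Steiner shells); it does not touch that skeleton.

The crux: for all NON-EMPTY compact convex ℚ-semialgebraic `K, L ⊂ ℝ²`, Blaschke's principal kinematic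
relator `[Inc(K,L), 2/(1+t²)] − [ℝ_t × K, 2/(1+t²)] − [ℝ_t × L, 2/(1+t²)] − [LineHit K × LineHit L, 4/((1+t²)(1+t′²))]`
lies in `KZ.relations` (values `2π(A_K + A_L) + L_K L_L − 2πA_K − 2πA_L − L_K L_L = 0`).

## The lever (why this line dodges the named risk of the crux and of line `birth`)

The crux's "why it might fail" and the hardest stub of `birth` (`stub_kinematicShellTransfer`) are the
same obstacle: the Gauss-map parametrisation of `∂K` degenerates at vertices, jumps at flat edges, and the
strata of `∂K` and of the ROTATING `∂M_t` (`M_t = −R_t L`) must be organised uniformly in `t`, with the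
parallel-edge coincidences excised — a cell decomposition in `t` whose combinatorics depends on `K`, `L`.
This line removes that step.  Two devices, both first-order definable from `K`, `L` (hence ℚ-semialgebraic
by Tarski–Seidenberg, uniformly, with no case analysis on the boundary structure):

* the **PROJECTION CHART** of the unit normal bundle `N¹K = {(x,u) : x ∈ ∂K, u ∈ N_K(x), |u| = 1}`:
  `w ↦ (x_K(w), u_K(w)) := (π_K(R u_w), unit(R u_w − π_K(R u_w)))`, `u_w = ((1−w²), 2w)/(1+w²)`, `R` a
  rational radius with `K` inside the open disc — a definable HOMEOMORPHISM of the circle onto `N¹K`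
  for EVERY non-empty compact convex `K` (bodies, segments, points alike): vertices of `K` become arcs of
  positive length (the normal turns, the point rests), edges become arcs along which the point moves and
  the normal rests; nothing degenerates, nothing jumps.  Its speed `a_K(w) = |x_K′(w)|` integrates to the
  perimeter `L_K = 2V₁(K)` and replaces the surface-area measure `dS_K` (atoms included) by the Lebesgue
  integrand `a_K(w) dw`;
* the **GAUGE FOLIATION** of `(K + M)∖K` (`0 ∈ M`): `y = x + s·m`, `s ∈ (0,1]` the gauge
  `min{s : y ∈ K + sM}`, `u` an outer normal of `K + sM` at `y`, `x ∈ F_K(u)`, `m ∈ F_M(u)` — in the chart,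
  ONE change of variables `Φ(t,w,s) = (t, x_K(w) + s·x_{M_t}(u_K(w)))` with Jacobian
  `(a_K(w) + s·b)·h_{M_t}(u_K(w))`, injective off the definable set where the Jacobian vanishes (whose
  image is null), missing only the triangles over the edges of `L` (which, with the `b`-term, are literally
  the same construction for the body `{0}` and cancel against `[ℝ_t × L]`).
After Newton–Leibniz in `s` and the torus shear `t′ = (1 + m t)/(t − m)`, `m = tan(θ_K(w)/2)`, the relator
`[Inc] − [ℝ×K] − [ℝ×L]` becomes the PRODUCT `[ℝ_w, a_K(w)] · [ℝ_t′, h_L(u_t′)·2/(1+t′²)]` (value `L_K·L_L`),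
and two ONE-BODY, uniform lemmas finish: `[ℝ_w, a_K] ~ [ℝ_t, h_K(u_t)·2/(1+t²)]` (Cauchy in the chart: the
continuous primitive `q = ⟨x_K, u_K^⊥⟩`) and `[ℝ_t, h_K·2/(1+t²)] ~ [LineHit K]` (Newton–Leibniz in `p`,
three sign cells, one antipodal Möbius move — no division by 2).

Skeleton = `stub_chartReps` (admissibility, S–M) → `stub_gaugeTransfer` (the core, L but uniform) →
`stub_chartCauchy` (M) → `stub_supportCrofton` (M); `KinematicPlaneConvexR_of_stubs` re-assembles them with
REAL glue from the tree (`IntegralRep.prod`, `KZ.of_mul_of`, the two-sided ideal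
`KZ.mul_sub_mul_mem_relations`, the congruence `KZ.of_sub_of_mem_relations_of_eqOn`), and
`KinematicPlaneConvexR_of : KinematicPlaneConvexR` concludes the crux BY NAME.

Inline gadgets (no definition is introduced; every stub is typed over existing declarations):
* `π_K(b)`  ↦ `Classical.epsilon (fun k => k ∈ K ∧ ∀ k' ∈ K, |b − k|² ≤ |b − k'|²)` (the nearest point: it
  exists and is unique for `b ∉ K`, so `epsilon` IS the metric projection there);
* `a_K^R(w)` ↦ `√((d/dw (π_K(R u_w))₀)² + (d/dw (π_K(R u_w))₁)²)` with Mathlib's `deriv` (junk value `0` at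
  the finitely many non-differentiable `w` — a null set);
* `h_K(u_t)` ↦ `sSup ((fun q => ((1 − t²)q₀ + 2t q₁)/(1 + t²)) '' K)`;
* `LineHit K` ↦ `{(t,p) : 0 ≤ p ∧ ∃ q ∈ K, (1 − t²)q₀ + 2t q₁ = (1 + t²)p}` (verbatim from the crux).

VALUE AUDIT (all non-empty cases; perimeter `L = 2V₁`, so `2·length` for a segment, `0` for a point):
`∫_ℝ a_K^R dw = L_K` (the chart traverses `∂K` once, a segment there and back, rests at a point);
`∫ h_K(u_t)·2dt/(1+t²) = ∫_{S¹} h_K dθ = L_K` for every position of `K`; `m(LineHit K) = L_K` (pairing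
`φ ↔ φ+π`); hence every stub relator has value `0`: `(2π(A_K+A_L) + L_K L_L) − 2πA_K − 2πA_L − L_K L_L`
(gauge transfer), `L_K − L_K` (twice).  `K.Nonempty`, `L.Nonempty` are carried by every stub (the `L = ∅`
witness that killed stmt-5394 is excluded).

Disproof used: none on file (`ledger crux ls stmt-KontsevichZagierPeriods-10736`: no Disproof.lean; `ledger
negatives --problem KontsevichZagierPeriods`: only the predecessor KinematicPlaneConvex, stmt-5394, `L = ∅`).
-/

set_option linter.dupNamespace false

namespace Summit.KontsevichZagierPeriods.KontsevichZagierPeriods.Cruxes.KinematicPlaneConvexR.GaugeChart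

open Set Literature.NumberTheory.Transcendental

/-- **ADMISSIBILITY OF THE CHART, SUPPORT AND HITTING REPRESENTATIONS** (one body). For a non-empty
compact convex ℚ-semialgebraic `K ⊂ ℝ²` there are a rational radius `R > 0` with `K` inside the open
disc `|k| < R`, and integral representations
`α = [ℝ_w, a_K^R(w)]` (the SPEED `|d/dw π_K(R·u_w)|` of the nearest-point projection of the circle
point `R·u_w`, `u_w = ((1−w²), 2w)/(1+w²)`: `w ↦ (π_K(R u_w), u)` is the PROJECTION CHART of the unit
normal bundle of `K`; value `∫ a_K^R = perimeter L_K = 2V₁(K)`),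
`σ = [ℝ_t, h_K(u_t)·2/(1+t²)]` (SUPPORT one-form, `h_K(u) = sup_{q ∈ K} ⟨q, u⟩`; value `∫ h_K dθ = L_K`)
and `ℓ = [LineHit K, 2/(1+t²)]` (value `L_K`, Cauchy–Crofton). Content: the three integrands /
domains are ℚ-semialgebraic (Tarski–Seidenberg: `π_K`, `h_K`, `LineHit` are first-order definable
from `K`; the derivative of a one-variable semialgebraic function is semialgebraic) and absolutely
integrable (`a_K^R(w) ≤ 2R/(1+w²)` since `π_K` is 1-Lipschitz; `|h_K| ≤ R`; `LineHit K ⊂ ℝ × [0, R]`). -/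
theorem stub_chartReps :
    ∀ K : Set (Fin 2 → ℝ), Literature.ModelTheory.ExponentialFields.IsSemialgebraic ℚ K → Convex ℝ K →
      IsCompact K → K.Nonempty →
      ∃ (R : ℚ) (α σ : Literature.NumberTheory.Transcendental.KZ.IntegralRep 1)
        (ℓ : Literature.NumberTheory.Transcendental.KZ.IntegralRep 2),
        0 < R ∧ (∀ k ∈ K, k 0 ^ 2 + k 1 ^ 2 < (R : ℝ) ^ 2) ∧
        α.domain = Set.univ ∧
        Set.EqOn α.integrand (fun x => Real.sqrt (deriv (fun w' : ℝ => Classical.epsilon (fun k : Fin 2 → ℝ => k ∈ K ∧ ∀ k' ∈ K, ((R : ℝ) * (1 - w' ^ 2) / (1 + w' ^ 2) - k 0) ^ 2 + ((R : ℝ) * (2 * w') / (1 + w' ^ 2) - k 1) ^ 2 ≤ ((R : ℝ) * (1 - w' ^ 2) / (1 + w' ^ 2) - k' 0) ^ 2 + ((R : ℝ) * (2 * w') / (1 + w' ^ 2) - k' 1) ^ 2) 0) (x 0) ^ 2 + deriv (fun w' : ℝ => Classical.epsilon (fun k : Fin 2 → ℝ => k ∈ K ∧ ∀ k' ∈ K,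 ((R : ℝ) * (1 - w' ^ 2) / (1 + w' ^ 2) - k 0) ^ 2 + ((R : ℝ) * (2 * w') / (1 + w' ^ 2) - k 1) ^ 2 ≤ ((R : ℝ) * (1 - w' ^ 2) / (1 + w' ^ 2) - k' 0) ^ 2 + ((R : ℝ) * (2 * w') / (1 + w' ^ 2) - k' 1) ^ 2) 1) (x 0) ^ 2)) Set.univ ∧
        σ.domain = Set.univ ∧
        Set.EqOn σ.integrand (fun x => sSup ((fun q : Fin 2 → ℝ => ((1 - x 0 ^ 2) * q 0 + 2 * x 0 * q 1) / (1 + x 0 ^ 2)) '' K) * (2 / (1 + x 0 ^ 2))) Set.univ ∧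
        ℓ.domain = {w : Fin 2 → ℝ | 0 ≤ w 1 ∧ ∃ q ∈ K, (1 - w 0 ^ 2) * q 0 + 2 * w 0 * q 1 = (1 + w 0 ^ 2) * w 1} ∧
        Set.EqOn ℓ.integrand (fun w => 2 / (1 + w 0 ^ 2)) ℓ.domain := by
  sorry

/-- **THE GAUGE TRANSFER** (the two-body core, UNIFORM in `K` and `L`: no stratification of `∂K`,
no cell decomposition in the rotation variable). For NON-EMPTY compact convex ℚ-semialgebraic
`K, L ⊂ ℝ²`, `R` as above and the crux data `r₀ = [Inc(K,L), 2/(1+t²)]`, `r₁ = [ℝ_t × K, 2/(1+t²)]`,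
`r₂ = [ℝ_t × L, 2/(1+t²)]`:  `[r₀] − [r₁] − [r₂] − [P] ∈ KZ.relations` for the PRODUCT
`P = [ℝ_w × ℝ_t′, a_K^R(w) · h_L(u_t′) · 2/(1+t′²)]` (value `L_K · L_L`; values of the left side
`2π(A_K + A_L) + L_K L_L − 2πA_K − 2πA_L`, SchneiderWeilLNM2007 Thm 1.5). Suggested chain (every set and
function below is first-order definable from `K`, `L`, hence ℚ-semialgebraic, uniformly):
(0) translate `L` so that `0 ∈ L` (a `v`-shear `(t,v) ↦ (t, v + R_t l₀)` on `Inc`, Jacobian 1; on the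
`P` side `h_{L−l₀} = h_L − ⟨l₀,u⟩` and `[ℝ, ⟨l₀,u_t⟩·2/(1+t²)] ~ 0` by a rational Newton–Leibniz);
(1) `Inc_t ⊇ K` fibrewise (`0 ∈ M_t := −R_t L`), so `[r₀] − [r₁] = [𝒰]`, `𝒰 = {(t,y) : y ∈ (K+M_t)∖K}`
(ONE domain-additivity move);
(2) GAUGE FOLIATION: every `y ∈ (K+M_t)∖K` is `x + s·m` with `s = min{s : y ∈ K + sM_t} ∈ (0,1]`,
`u` an outer normal of `K + sM_t` at `y`, `x ∈ F_K(u)`, `m ∈ F_{M_t}(u)`; with the projection chart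
`w ↦ (x_K(w), u_K(w)) := (π_K(R u_w), unit(R u_w − π_K(R u_w)))` of the unit normal bundle this is
the map `Φ(t,w,s) = (t, x_K(w) + s·x_{M_t}(u_K(w)))`, injective and differentiable on the definable
co-null set `Ω = {h_{M_t}(u_K w) > 0, Φ differentiable, w ∉ Z̄_t}` (`Z̄_t` = directions sharing both
support points with another direction — vertex-against-vertex cones, where the Jacobian vanishes
and whose image is a null union of segments; injectivity elsewhere: `x − x′ = s(m′ − m)` is
`⟨·,u⟩`- and `⟨·,u′⟩`-orthogonal), with `|det DΦ| = (a_K(w) + s·b(t,w))·h_{M_t}(u_K(w))`,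
`a_K = |x_K′|` (tangential), `b = |d/dw x_{M_t}(u_K(w))| ≥ 0`; the pieces of `𝒰` missed by `Φ(Ω)` are
the TRIANGLES `x_K(n_f) + (0,1]·f_t` over the edges `f` of `L` and null sets — one change of
variables + one domain additivity;
(3) Newton–Leibniz in `s` (primitive `(a s + b s²/2) h`, polynomial in `s`);
(4) the `½ b h` term and the triangles are EXACTLY the same construction for the body `{0}` in
place of `K` (chart `u_{0}(w) = u_w`; reparametrise `w ↦ θ_K(w)` where `θ_K′ > 0`, translate the
triangles by `x_K(n_f(t))`), and `[𝒰({0},L)] = [{(t,y) : y ∈ M_t ∖ 0}] ~ [r₂]` by the fibrewise rotation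
— so `[r₀] − [r₁] − [r₂] ~ [ℝ_t × ℝ_w, a_K(w)·h_{M_t}(u_K(w))·2/(1+t²)]`;
(5) TORUS SHEAR `t′ = (1 + m t)/(t − m)`, `m = tan(θ_K(w)/2)` (Möbius in `t`, coefficients
semialgebraic in `w`, `2dt/(1+t²) = 2dt′/(1+t′²)`, and `h_{M_t}(u_K w) = h_L(u_{t′})`): the integrand
becomes `a_K(w)·h_L(u_{t′})·2/(1+t′²)` — the product `P` (coordinate swap by
`KZ.of_sub_of_reindex_mem_relations`). Degenerate bodies need no separate treatment (segments: the
chart runs along both sides; points: `a_K ≡ 0`). -/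
theorem stub_gaugeTransfer :
    ∀ K L : Set (Fin 2 → ℝ), Literature.ModelTheory.ExponentialFields.IsSemialgebraic ℚ K →
      Literature.ModelTheory.ExponentialFields.IsSemialgebraic ℚ L → Convex ℝ K → Convex ℝ L →
      IsCompact K → IsCompact L → K.Nonempty → L.Nonempty →
      ∀ R : ℚ, 0 < R → (∀ k ∈ K, k 0 ^ 2 + k 1 ^ 2 < (R : ℝ) ^ 2) →
      ∀ (r₀ r₁ r₂ : Literature.NumberTheory.Transcendental.KZ.IntegralRep 3),
        r₀.domain = {x : Fin 3 → ℝ | ∃ q ∈ L, (![((1 - x 0 ^ 2) * q 0 - 2 * x 0 * q 1) / (1 + x 0 ^ 2) + x 1,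
          (2 * x 0 * q 0 + (1 - x 0 ^ 2) * q 1) / (1 + x 0 ^ 2) + x 2] : Fin 2 → ℝ) ∈ K} →
        Set.EqOn r₀.integrand (fun x => 2 / (1 + x 0 ^ 2)) r₀.domain →
        r₁.domain = {x : Fin 3 → ℝ | (![x 1, x 2] : Fin 2 → ℝ) ∈ K} →
        Set.EqOn r₁.integrand (fun x => 2 / (1 + x 0 ^ 2)) r₁.domain →
        r₂.domain = {x : Fin 3 → ℝ | (![x 1, x 2] : Fin 2 → ℝ) ∈ L} →
        Set.EqOn r₂.integrand (fun x => 2 / (1 + x 0 ^ 2)) r₂.domain →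
      ∀ (P : Literature.NumberTheory.Transcendental.KZ.IntegralRep 2), P.domain = Set.univ →
        Set.EqOn P.integrand
          (fun z => Real.sqrt (deriv (fun w' : ℝ => Classical.epsilon (fun k : Fin 2 → ℝ => k ∈ K ∧ ∀ k' ∈ K, ((R : ℝ) * (1 - w' ^ 2) / (1 + w' ^ 2) - k 0) ^ 2 + ((R : ℝ) * (2 * w') / (1 + w' ^ 2) - k 1) ^ 2 ≤ ((R : ℝ) * (1 - w' ^ 2) / (1 + w' ^ 2) - k' 0) ^ 2 + ((R : ℝ) * (2 * w') / (1 + w' ^ 2) - k' 1) ^ 2) 0) (z 0) ^ 2 + deriv (fun w' : ℝ => Classical.epsilon (fun k : Fin 2 → ℝ => k ∈ K ∧ ∀ k' ∈ K, ((R : ℝ) * (1 - w' ^ 2) / (1 + w' ^ 2) - k 0) ^ 2 + ((R : ℝ) * (2 * w') / (1 + w' ^ 2) - k 1) ^ 2 ≤ ((R : ℝ) * (1 - w' ^ 2) / (1 + w' ^ 2) - k' 0) ^ 2 + ((R : ℝ) * (2 * w') / (1 + w' ^ 2) - k' 1) ^ 2) 1) (z 0) ^ 2) *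
            (sSup ((fun q : Fin 2 → ℝ => ((1 - z 1 ^ 2) * q 0 + 2 * z 1 * q 1) / (1 + z 1 ^ 2)) '' L) * (2 / (1 + z 1 ^ 2)))) Set.univ →
        Literature.NumberTheory.Transcendental.KZ.of r₀ - Literature.NumberTheory.Transcendental.KZ.of r₁ -
            Literature.NumberTheory.Transcendental.KZ.of r₂ - Literature.NumberTheory.Transcendental.KZ.of P ∈
          Literature.NumberTheory.Transcendental.KZ.relations := by
  sorry

/-- **CAUCHY IN THE PROJECTION CHART** (one body, uniform): `[ℝ_w, a_K^R(w)] − [ℝ_t, h_K(u_t)·2/(1+t²)]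
∈ KZ.relations` (both values `L_K`: length of `∂K` traversed once by `w ↦ π_K(R u_w)` — twice along a
segment — equals `∫ h_K dθ`). Suggested chain: with `x = x_K(w)`, `u = u_K(w) = (cos θ_K(w), sin θ_K(w))`,
the definable CONTINUOUS function `q(w) = ⟨x(w), u(w)^⊥⟩` (= `h_K′` resolved through the chart: no jumps
at the edges of `K`) has `q′ = a_K − h_K(u_K(w))·θ_K′(w)` off finitely many `w`; so integrand additivity,
Newton–Leibniz for `q′` on the finitely many intervals of differentiability (boundary terms telescope,
`q(±∞)` agree), and the change of variables `w ↦ tan(θ_K(w)/2)` on `{θ_K′ > 0}` (injective off a finite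
set; on `{θ_K′ = 0}` — the edges — the integrand `h θ′` vanishes) carrying `h_K(u_K(w))θ_K′(w) dw` to
`h_K(u_t)·2dt/(1+t²)`. -/
theorem stub_chartCauchy :
    ∀ K : Set (Fin 2 → ℝ), Literature.ModelTheory.ExponentialFields.IsSemialgebraic ℚ K → Convex ℝ K →
      IsCompact K → K.Nonempty →
      ∀ R : ℚ, 0 < R → (∀ k ∈ K, k 0 ^ 2 + k 1 ^ 2 < (R : ℝ) ^ 2) →
      ∀ (α σ : Literature.NumberTheory.Transcendental.KZ.IntegralRep 1), α.domain = Set.univ →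
        Set.EqOn α.integrand (fun x => Real.sqrt (deriv (fun w' : ℝ => Classical.epsilon (fun k : Fin 2 → ℝ => k ∈ K ∧ ∀ k' ∈ K, ((R : ℝ) * (1 - w' ^ 2) / (1 + w' ^ 2) - k 0) ^ 2 + ((R : ℝ) * (2 * w') / (1 + w' ^ 2) - k 1) ^ 2 ≤ ((R : ℝ) * (1 - w' ^ 2) / (1 + w' ^ 2) - k' 0) ^ 2 + ((R : ℝ) * (2 * w') / (1 + w' ^ 2) - k' 1) ^ 2) 0) (x 0) ^ 2 + deriv (fun w' : ℝ => Classical.epsilon (fun k : Fin 2 → ℝ => k ∈ K ∧ ∀ k' ∈ K, ((R : ℝ) * (1 - w' ^ 2) / (1 + w' ^ 2) - k 0) ^ 2 + ((R : ℝ) * (2 * w') / (1 + w' ^ 2) - k 1) ^ 2 ≤ ((R : ℝ) * (1 - w' ^ 2) / (1 + w' ^ 2) - k' 0) ^ 2 + ((R : ℝ) * (2 * w') / (1 + w' ^ 2) - k' 1) ^ 2) 1) (x 0) ^ 2)) Set.univ →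
        σ.domain = Set.univ →
        Set.EqOn σ.integrand (fun x => sSup ((fun q : Fin 2 → ℝ => ((1 - x 0 ^ 2) * q 0 + 2 * x 0 * q 1) / (1 + x 0 ^ 2)) '' K) * (2 / (1 + x 0 ^ 2))) Set.univ →
        Literature.NumberTheory.Transcendental.KZ.of α - Literature.NumberTheory.Transcendental.KZ.of σ ∈
          Literature.NumberTheory.Transcendental.KZ.relations := by
  sorry

/-- **SUPPORT-TO-LINES (Cauchy–Crofton in support form)** (one body, uniform, no halving):
`[ℝ_t, h_K(u_t)·2/(1+t²)] − [LineHit K, 2/(1+t²)] ∈ KZ.relations` (both values `L_K` for every position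
of `K`). Suggested chain: `LineHit K` is the band `{max(0, m_K(t)) ≤ p ≤ h_K(t)}` over `{h_K ≥ 0}` with
`m_K(t) = min_K ⟨q,u_t⟩ = −h_K(t*)`, `t* = −1/t` (antipode); Newton–Leibniz in `p` (primitive
`2p/(1+t²)`, pattern `CroftonEllipse.band_sub_base_mem`) gives `[{h_K ≥ 0}, (h_K − max(0,m_K))·2/(1+t²)]`;
split into the sign cells `{m_K ≥ 0}` (integrand `h_K(t) + h_K(t*)`), `{m_K < 0 ≤ h_K}` (integrand `h_K`)
and compare with `[ℝ, h_K] = [{m_K ≥ 0}] + [{m_K < 0 ≤ h_K}] + [{h_K < 0}]`: the surplus `[{m_K ≥ 0}, h_K(t*)]`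
is carried by the antipodal Möbius change of variables `t ↦ −1/t` (round measure preserved) onto
`[{h_K ≤ 0}, h_K(t)]`, which is the deficit `[{h_K < 0}, h_K]` plus a zero-integrand set — every step a
single move, integer coefficients only. -/
theorem stub_supportCrofton :
    ∀ K : Set (Fin 2 → ℝ), Literature.ModelTheory.ExponentialFields.IsSemialgebraic ℚ K → Convex ℝ K →
      IsCompact K → K.Nonempty →
      ∀ (σ : Literature.NumberTheory.Transcendental.KZ.IntegralRep 1)
        (ℓ : Literature.NumberTheory.Transcendental.KZ.IntegralRep 2), σ.domain = Set.univ →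
        Set.EqOn σ.integrand (fun x => sSup ((fun q : Fin 2 → ℝ => ((1 - x 0 ^ 2) * q 0 + 2 * x 0 * q 1) / (1 + x 0 ^ 2)) '' K) * (2 / (1 + x 0 ^ 2))) Set.univ →
        ℓ.domain = {w : Fin 2 → ℝ | 0 ≤ w 1 ∧ ∃ q ∈ K, (1 - w 0 ^ 2) * q 0 + 2 * w 0 * q 1 = (1 + w 0 ^ 2) * w 1} →
        Set.EqOn ℓ.integrand (fun w => 2 / (1 + w 0 ^ 2)) ℓ.domain →
        Literature.NumberTheory.Transcendental.KZ.of σ - Literature.NumberTheory.Transcendental.KZ.of ℓ ∈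
          Literature.NumberTheory.Transcendental.KZ.relations := by
  sorry

/-- **ASSEMBLY, arrow form** (kernel-checked, no `sorry`): the four stub statements imply the crux
statement, unfolded verbatim. Proof: charts/support/hitting representations of `K` and `L`
(`stub_chartReps`); the gauge transfer with `P := α_K.prod σ_L` (`stub_gaugeTransfer`; the product has
exactly the typed domain/integrand by `IntegralRep.prod_domain`, `prod_integrand_eq`); then
`[α_K] ~ [σ_K] ~ [ℓ_K]` (`stub_chartCauchy`, `stub_supportCrofton`) and `[σ_L] ~ [ℓ_L]`, so
`[α_K]·[σ_L] ~ [ℓ_K]·[ℓ_L]` (`KZ.of_mul_of`, two-sided ideal `KZ.mul_sub_mul_mem_relations`), and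
`[ℓ_K.prod ℓ_L]` is congruent to the crux's `r₃` (`KZ.of_sub_of_mem_relations_of_eqOn`); add. -/
theorem KinematicPlaneConvexR_of_stubs :
    (∀ K : Set (Fin 2 → ℝ), Literature.ModelTheory.ExponentialFields.IsSemialgebraic ℚ K → Convex ℝ K →
      IsCompact K → K.Nonempty →
      ∃ (R : ℚ) (α σ : Literature.NumberTheory.Transcendental.KZ.IntegralRep 1)
        (ℓ : Literature.NumberTheory.Transcendental.KZ.IntegralRep 2),
        0 < R ∧ (∀ k ∈ K, k 0 ^ 2 + k 1 ^ 2 < (R : ℝ) ^ 2) ∧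
        α.domain = Set.univ ∧
        Set.EqOn α.integrand (fun x => Real.sqrt (deriv (fun w' : ℝ => Classical.epsilon (fun k : Fin 2 → ℝ => k ∈ K ∧ ∀ k' ∈ K, ((R : ℝ) * (1 - w' ^ 2) / (1 + w' ^ 2) - k 0) ^ 2 + ((R : ℝ) * (2 * w') / (1 + w' ^ 2) - k 1) ^ 2 ≤ ((R : ℝ) * (1 - w' ^ 2) / (1 + w' ^ 2) - k' 0) ^ 2 + ((R : ℝ) * (2 * w') / (1 + w' ^ 2) - k' 1) ^ 2) 0) (x 0) ^ 2 + deriv (fun w' : ℝ => Classical.epsilon (fun k : Fin 2 → ℝ => k ∈ K ∧ ∀ k' ∈ K, ((R : ℝ) * (1 - w' ^ 2) / (1 + w' ^ 2) - k 0) ^ 2 + ((R : ℝ) * (2 * w') / (1 + w' ^ 2) - k 1) ^ 2 ≤ ((R : ℝ) * (1 - w' ^ 2) / (1 + w' ^ 2) - k' 0) ^ 2 + ((R : ℝ) * (2 * w') / (1 + w' ^ 2) - k' 1) ^ 2) 1) (x 0) ^ 2)) Set.univ ∧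
        σ.domain = Set.univ ∧
        Set.EqOn σ.integrand (fun x => sSup ((fun q : Fin 2 → ℝ => ((1 - x 0 ^ 2) * q 0 + 2 * x 0 * q 1) / (1 + x 0 ^ 2)) '' K) * (2 / (1 + x 0 ^ 2))) Set.univ ∧
        ℓ.domain = {w : Fin 2 → ℝ | 0 ≤ w 1 ∧ ∃ q ∈ K, (1 - w 0 ^ 2) * q 0 + 2 * w 0 * q 1 = (1 + w 0 ^ 2) * w 1} ∧
        Set.EqOn ℓ.integrand (fun w => 2 / (1 + w 0 ^ 2)) ℓ.domain) →
    (∀ K L : Set (Fin 2 → ℝ), Literature.ModelTheory.ExponentialFields.IsSemialgebraic ℚ K →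
      Literature.ModelTheory.ExponentialFields.IsSemialgebraic ℚ L → Convex ℝ K → Convex ℝ L →
      IsCompact K → IsCompact L → K.Nonempty → L.Nonempty →
      ∀ R : ℚ, 0 < R → (∀ k ∈ K, k 0 ^ 2 + k 1 ^ 2 < (R : ℝ) ^ 2) →
      ∀ (r₀ r₁ r₂ : Literature.NumberTheory.Transcendental.KZ.IntegralRep 3),
        r₀.domain = {x : Fin 3 → ℝ | ∃ q ∈ L, (![((1 - x 0 ^ 2) * q 0 - 2 * x 0 * q 1) / (1 + x 0 ^ 2) + x 1,
          (2 * x 0 * q 0 + (1 - x 0 ^ 2) * q 1) / (1 + x 0 ^ 2) + x 2] : Fin 2 → ℝ) ∈ K} →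
        Set.EqOn r₀.integrand (fun x => 2 / (1 + x 0 ^ 2)) r₀.domain →
        r₁.domain = {x : Fin 3 → ℝ | (![x 1, x 2] : Fin 2 → ℝ) ∈ K} →
        Set.EqOn r₁.integrand (fun x => 2 / (1 + x 0 ^ 2)) r₁.domain →
        r₂.domain = {x : Fin 3 → ℝ | (![x 1, x 2] : Fin 2 → ℝ) ∈ L} →
        Set.EqOn r₂.integrand (fun x => 2 / (1 + x 0 ^ 2)) r₂.domain →
      ∀ (P : Literature.NumberTheory.Transcendental.KZ.IntegralRep 2), P.domain = Set.univ →
        Set.EqOn P.integrand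
          (fun z => Real.sqrt (deriv (fun w' : ℝ => Classical.epsilon (fun k : Fin 2 → ℝ => k ∈ K ∧ ∀ k' ∈ K, ((R : ℝ) * (1 - w' ^ 2) / (1 + w' ^ 2) - k 0) ^ 2 + ((R : ℝ) * (2 * w') / (1 + w' ^ 2) - k 1) ^ 2 ≤ ((R : ℝ) * (1 - w' ^ 2) / (1 + w' ^ 2) - k' 0) ^ 2 + ((R : ℝ) * (2 * w') / (1 + w' ^ 2) - k' 1) ^ 2) 0) (z 0) ^ 2 + deriv (fun w' : ℝ => Classical.epsilon (fun k : Fin 2 → ℝ => k ∈ K ∧ ∀ k' ∈ K, ((R : ℝ) * (1 - w' ^ 2) / (1 + w' ^ 2) - k 0) ^ 2 + ((R : ℝ) * (2 * w') / (1 + w' ^ 2) - k 1) ^ 2 ≤ ((R : ℝ) * (1 - w' ^ 2) / (1 + w' ^ 2) - k' 0) ^ 2 + ((R : ℝ) * (2 * w') / (1 + w' ^ 2) - k' 1) ^ 2) 1) (z 0) ^ 2) *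
            (sSup ((fun q : Fin 2 → ℝ => ((1 - z 1 ^ 2) * q 0 + 2 * z 1 * q 1) / (1 + z 1 ^ 2)) '' L) * (2 / (1 + z 1 ^ 2)))) Set.univ →
        Literature.NumberTheory.Transcendental.KZ.of r₀ - Literature.NumberTheory.Transcendental.KZ.of r₁ -
            Literature.NumberTheory.Transcendental.KZ.of r₂ - Literature.NumberTheory.Transcendental.KZ.of P ∈
          Literature.NumberTheory.Transcendental.KZ.relations) →
    (∀ K : Set (Fin 2 → ℝ), Literature.ModelTheory.ExponentialFields.IsSemialgebraic ℚ K → Convex ℝ K →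
      IsCompact K → K.Nonempty →
      ∀ R : ℚ, 0 < R → (∀ k ∈ K, k 0 ^ 2 + k 1 ^ 2 < (R : ℝ) ^ 2) →
      ∀ (α σ : Literature.NumberTheory.Transcendental.KZ.IntegralRep 1), α.domain = Set.univ →
        Set.EqOn α.integrand (fun x => Real.sqrt (deriv (fun w' : ℝ => Classical.epsilon (fun k : Fin 2 → ℝ => k ∈ K ∧ ∀ k' ∈ K, ((R : ℝ) * (1 - w' ^ 2) / (1 + w' ^ 2) - k 0) ^ 2 + ((R : ℝ) * (2 * w') / (1 + w' ^ 2) - k 1) ^ 2 ≤ ((R : ℝ) * (1 - w' ^ 2) / (1 + w' ^ 2) - k' 0) ^ 2 + ((R : ℝ) * (2 * w') / (1 + w' ^ 2) - k' 1) ^ 2) 0) (x 0) ^ 2 + deriv (fun w' : ℝ => Classical.epsilon (fun k : Fin 2 → ℝ => k ∈ K ∧ ∀ k' ∈ K, ((R : ℝ) * (1 - w' ^ 2) / (1 + w' ^ 2) - k 0) ^ 2 + ((R : ℝ) * (2 * w') / (1 + w' ^ 2) - k 1) ^ 2 ≤ ((R : ℝ) * (1 - w' ^ 2) / (1 + w'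 ^ 2) - k' 0) ^ 2 + ((R : ℝ) * (2 * w') / (1 + w' ^ 2) - k' 1) ^ 2) 1) (x 0) ^ 2)) Set.univ →
        σ.domain = Set.univ →
        Set.EqOn σ.integrand (fun x => sSup ((fun q : Fin 2 → ℝ => ((1 - x 0 ^ 2) * q 0 + 2 * x 0 * q 1) / (1 + x 0 ^ 2)) '' K) * (2 / (1 + x 0 ^ 2))) Set.univ →
        Literature.NumberTheory.Transcendental.KZ.of α - Literature.NumberTheory.Transcendental.KZ.of σ ∈
          Literature.NumberTheory.Transcendental.KZ.relations) →
    (∀ K : Set (Fin 2 → ℝ), Literature.ModelTheory.ExponentialFields.IsSemialgebraic ℚ K → Convex ℝ K →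
      IsCompact K → K.Nonempty →
      ∀ (σ : Literature.NumberTheory.Transcendental.KZ.IntegralRep 1)
        (ℓ : Literature.NumberTheory.Transcendental.KZ.IntegralRep 2), σ.domain = Set.univ →
        Set.EqOn σ.integrand (fun x => sSup ((fun q : Fin 2 → ℝ => ((1 - x 0 ^ 2) * q 0 + 2 * x 0 * q 1) / (1 + x 0 ^ 2)) '' K) * (2 / (1 + x 0 ^ 2))) Set.univ →
        ℓ.domain = {w : Fin 2 → ℝ | 0 ≤ w 1 ∧ ∃ q ∈ K, (1 - w 0 ^ 2) * q 0 + 2 * w 0 * q 1 = (1 + w 0 ^ 2) * w 1} →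
        Set.EqOn ℓ.integrand (fun w => 2 / (1 + w 0 ^ 2)) ℓ.domain →
        Literature.NumberTheory.Transcendental.KZ.of σ - Literature.NumberTheory.Transcendental.KZ.of ℓ ∈
          Literature.NumberTheory.Transcendental.KZ.relations) →
    ∀ K L : Set (Fin 2 → ℝ), Literature.ModelTheory.ExponentialFields.IsSemialgebraic ℚ K → Literature.ModelTheory.ExponentialFields.IsSemialgebraic ℚ L → Convex ℝ K → Convex ℝ L → IsCompact K → IsCompact L → K.Nonempty → L.Nonempty → ∀ (r₀ r₁ r₂ : Literature.NumberTheory.Transcendental.KZ.IntegralRep 3) (r₃ : Literature.NumberTheory.Transcendental.KZ.IntegralRep 4), r₀.domain = {x : Fin 3 → ℝ | ∃ q ∈ L, (![((1 - x 0 ^ 2) * q 0 - 2 * x 0 * q 1) / (1 + x 0 ^ 2) + x 1, (2 * x 0 * q 0 + (1 - x 0 ^ 2) * q 1) / (1 + x 0 ^ 2) + x 2] : Fin 2 → ℝ) ∈ K} → Set.EqOn r₀.integrand (fun x => 2 / (1 + x 0 ^ 2)) r₀.domain → r₁.domain = {x : Fin 3 → ℝ | (![x 1, x 2] : Fin 2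 → ℝ) ∈ K} → Set.EqOn r₁.integrand (fun x => 2 / (1 + x 0 ^ 2)) r₁.domain → r₂.domain = {x : Fin 3 → ℝ | (![x 1, x 2] : Fin 2 → ℝ) ∈ L} → Set.EqOn r₂.integrand (fun x => 2 / (1 + x 0 ^ 2)) r₂.domain → r₃.domain = {z : Fin 4 → ℝ | (0 ≤ z 1 ∧ ∃ q ∈ K, (1 - z 0 ^ 2) * q 0 + 2 * z 0 * q 1 = (1 + z 0 ^ 2) * z 1) ∧ (0 ≤ z 3 ∧ ∃ q ∈ L, (1 - z 2 ^ 2) * q 0 + 2 * z 2 * q 1 = (1 + z 2 ^ 2) * z 3)} → Set.EqOn r₃.integrand (fun z => 4 / ((1 + z 0 ^ 2) * (1 + z 2 ^ 2))) r₃.domain → Literature.NumberTheory.Transcendental.KZ.of r₀ - Literature.NumberTheory.Transcendental.KZ.of r₁ - Literature.NumberTheory.Transcendental.KZ.of r₂ - Literature.NumberTheory.Transcendental.KZ.of r₃ ∈ Literature.NumberTheory.Transcendental.KZ.relations := by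
  intro hReps hGauge hChart hCrofton K L hK hL hcK hcL hKc hLc hKn hLn r₀ r₁ r₂ r₃ h0d h0i h1d h1i h2d h2i
    h3d h3i
  -- chart / support / hitting representations of `K`, support / hitting representations of `L`
  obtain ⟨R, αK, σK, ℓK, hR, hKR, hαd, hαi, hσKd, hσKi, hℓKd, hℓKi⟩ := hReps K hK hcK hKc hKn
  obtain ⟨_, _, σL, ℓL, -, -, -, -, hσLd, hσLi, hℓLd, hℓLi⟩ := hReps L hL hcL hLc hLn
  -- coordinate bookkeeping on `Fin 2 = Fin (1 + 1)` and `Fin 4 = Fin (2 + 2)`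
  have hc1 : ∀ z : Fin (1 + 1) → ℝ, (fun i : Fin 1 => z (Fin.castAdd 1 i)) 0 = z 0 := fun z => rfl
  have hn1 : ∀ z : Fin (1 + 1) → ℝ, (fun j : Fin 1 => z (Fin.natAdd 1 j)) 0 = z 1 := fun z => rfl
  have hcast : ∀ z : Fin (2 + 2) → ℝ, (fun i : Fin 2 => z (Fin.castAdd 2 i)) = ![z 0, z 1] := by
    intro z; funext i; fin_cases i <;> rfl
  have hnat : ∀ z : Fin (2 + 2) → ℝ, (fun j : Fin 2 => z (Fin.natAdd 2 j)) = ![z 2, z 3] := by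
    intro z; funext j; fin_cases j <;> rfl
  -- the product `P := α_K.prod σ_L` has exactly the domain and integrand the gauge stub wants
  have hPd : (αK.prod σL).domain = Set.univ := by
    ext z
    simp only [KZ.IntegralRep.prod_domain, KZ.IntegralRep.mem_prodDomain, hαd, hσLd, Set.mem_univ,
      and_self]
  have hPi : Set.EqOn (αK.prod σL).integrand
      (fun z => αK.integrand (fun i : Fin 1 => z (Fin.castAdd 1 i)) *
        σL.integrand (fun j : Fin 1 => z (Fin.natAdd 1 j))) Set.univ := by
    intro z _
    rw [KZ.IntegralRep.prod_integrand_eq, KZ.IntegralRep.prodFun_apply]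
  have hPi' : ∀ z : Fin (1 + 1) → ℝ, (αK.prod σL).integrand z =
      αK.integrand (fun i : Fin 1 => z (Fin.castAdd 1 i)) *
        σL.integrand (fun j : Fin 1 => z (Fin.natAdd 1 j)) := fun z => hPi (Set.mem_univ z)
  have hcore : KZ.of r₀ - KZ.of r₁ - KZ.of r₂ - KZ.of (αK.prod σL) ∈ KZ.relations := by
    refine hGauge K L hK hL hcK hcL hKc hLc hKn hLn R hR hKR r₀ r₁ r₂ h0d h0i h1d h1i h2d h2i
      (αK.prod σL) hPd ?_
    intro z _
    rw [hPi' z, hαi (Set.mem_univ _), hσLi (Set.mem_univ _)]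
    rfl
  -- one-body conversions: chart → support → lines for `K`, support → lines for `L`
  have hDK : KZ.of αK - KZ.of σK ∈ KZ.relations := hChart K hK hcK hKc hKn R hR hKR αK σK hαd hαi hσKd hσKi
  have hBK : KZ.of σK - KZ.of ℓK ∈ KZ.relations := hCrofton K hK hcK hKc hKn σK ℓK hσKd hσKi hℓKd hℓKi
  have hBL : KZ.of σL - KZ.of ℓL ∈ KZ.relations := hCrofton L hL hcL hLc hLn σL ℓL hσLd hσLi hℓLd hℓLi
  have hαℓ : KZ.of αK - KZ.of ℓK ∈ KZ.relations := by
    have h := KZ.relations.add_mem hDK hBK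
    rwa [sub_add_sub_cancel] at h
  -- two-sided ideal: `[α_K]·[σ_L] ~ [ℓ_K]·[ℓ_L]`
  have hprod : KZ.of (αK.prod σL) - KZ.of (ℓK.prod ℓL) ∈ KZ.relations := by
    rw [← KZ.of_mul_of, ← KZ.of_mul_of]
    exact KZ.mul_sub_mul_mem_relations hαℓ hBL
  -- `[LineHit K].prod [LineHit L]` is congruent to the crux's `r₃`
  have hr₃ : KZ.of (ℓK.prod ℓL) - KZ.of r₃ ∈ KZ.relations := by
    refine KZ.of_sub_of_mem_relations_of_eqOn ?_ ?_
    · rw [h3d]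
      ext z
      rw [KZ.IntegralRep.prod_domain, KZ.IntegralRep.mem_prodDomain, hcast z, hnat z, hℓKd, hℓLd]
      simp
    · intro z hz
      have hz' := hz
      rw [KZ.IntegralRep.prod_domain, KZ.IntegralRep.mem_prodDomain] at hz'
      have hz₃ : z ∈ r₃.domain := by
        rw [h3d]
        rw [hcast z, hnat z, hℓKd, hℓLd] at hz'
        simpa using hz'
      rw [KZ.IntegralRep.prod_integrand_eq, KZ.IntegralRep.prodFun_apply, hℓKi hz'.1, hℓLi hz'.2,
        h3i hz₃, hcast z, hnat z]
      simp only [Matrix.cons_val_zero]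
      rw [div_mul_div_comm]
      norm_num
  -- subgroup arithmetic
  have hsum := KZ.relations.add_mem (KZ.relations.add_mem hcore hprod) hr₃
  convert hsum using 1
  abel

/-- **The skeleton theorem**: concludes the crux `KinematicPlaneConvexR` BY NAME — the four stubs fed
into `KinematicPlaneConvexR_of_stubs`; its only `sorryAx` dependencies are `stub_chartReps`,
`stub_gaugeTransfer`, `stub_chartCauchy`, `stub_supportCrofton`. -/
theorem KinematicPlaneConvexR_of :
    Summit.KontsevichZagierPeriods.KontsevichZagierPeriods.Theses.KinematicFormulas.KinematicPlaneConvexR :=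
  KinematicPlaneConvexR_of_stubs stub_chartReps stub_gaugeTransfer stub_chartCauchy stub_supportCrofton

end Summit.KontsevichZagierPeriods.KontsevichZagierPeriods.Cruxes.KinematicPlaneConvexR.GaugeChart
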